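import Literature.AlgebraicGeometry.Frobenioids.Cor411AsPrinted
import Literature.AlgebraicGeometry.Frobenioids.Cor411OfPreStepsDataWeak
import Literature.AlgebraicGeometry.Frobenioids.Cor411iiOfThm34iiWeak
import HarnessLib

/-!
# Frobenioids I, Corollary 4.11 (iii)(iv) AS TYPED, in print's generality, for EVERY pair of Frobenioids with
# WEAKLY perf-factorial `Φ_i` — weak twin of the (iii)/(iv) part of `Cor411AsPrinted.lean`

Mochizuki, *The geometry of Frobenioids I: the general theory*, Kyushu J. Math. **62** (2008)
293–400, kurims text: Cor. 4.11 (iii), (iv) pp. 91–92, proof pp. 92–94 [cite: MochizukiFrdI2008, Cor. 4.11 (iv) p.92];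
Theorem 3.4 (ii) p. 62; Theorem 4.9 pp. 88–90.

PROOF-ONLY weak twin (cell abc-iut, layer L1, seat abc-iut-L1-t11; [FrdI] Thm. 4.9 / Cor. 4.11 (iii)(iv) WEAK
programme, block (T3) top = the CLOSERS, basename fence of 2026-08-26 with seat abc-iut-L1-t14) of the seven
(iii)/(iv) statements of `Cor411AsPrinted.lean` (seat abc-iut-L1-d6): the SAME statements with the §4 standing
hypothesis "`Φ_i` perf-factorial" (Def. 2.4 (i) (a)–(d) as printed) REPLACED by the named weakening
`IsPerfFactorialWeak` of `PerfFactorialWeak.lean` ((a)–(c) verbatim + (d_ord), (d_res)). WHY (cell finding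
F-L2d2-1): condition (d) FAILS for the divisor monoids of the tempered Frobenioids of [EtTh] §3–§5 (infinite
products of monoprime monoids; kernel witness `PerfFactorialProductCounterexample.not_isPerfFactorial_multiplicative_pi_nat`),
which is exactly where [EtTh] Cor. 3.8 (iii) p. 81 ("the induced isomorphism of divisor monoids `Ψ^Φ` … of
[FrdI], Theorem 4.9") and Prop. 5.3 p. 99 (`Ψ^Φ_A`) invoke Thm. 4.9, and [IUTchI] Def. 3.6 (a) p. 87 invokes
Cor. 4.11 (iv) (at `v ∈ V^bad`). Proofs verbatim; inputs BY NAME: Thm. 3.4 (ii) AS PRINTED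
(`FrdI.thm34ii_ofFunctor`, 2008 FSMFF wording, `EquivalencePreStepsFSMFF2008Assembly.lean`), the weak (ii) closer
`FrdI.cor411ii_ofFunctor_weak` (`Cor411iiOfThm34iiWeak.lean`, seat abc-iut-L1-t12), and the weak (iii)/(iv)-from-(ii)
layer `Cor411OfPreStepsWeak.lean` / `Cor411OfPreStepsDataWeak.lean`; `FrdI.preservesDegFr_of_cor411Setting` has no
perf-factorial hypothesis and is not twinned; (d) itself is never used. Names = strong names + `_weak`. The printed
(strong) case is recovered through `IsPerfFactorial.weak`. No new definitions; nothing printed is restated as if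
corrected; nothing here is specific to the abc programme and no side is taken on [IUTchIII] Cor. 3.12.

* `FrdI.cor411iii_ofFunctor_weak` / `FrdI.cor411iv_ofFunctor_weak` — **the typed Cor. 4.11 (iii) / (iv) for EVERY
  pair of Frobenioids `C_i → F_{Φ_i}` with WEAKLY perf-factorial `Φ_i`, EVERY equivalence `Ψ`, arbitrary
  `R_i : RSParams`, `C₁` of rational type at THE birationalization / support — NO hypothesis on the bases**;
  `…_of_thm34ii_weak` = the same from the typed Thm. 3.4 (ii) for `Ψ`, `Ψ⁻¹`;
* `FrdI.exists_divisorMonoidIsoOver_div_ofFunctor_weak` — Thm. 4.9's `Ψ^Φ` over `Ψ` WITH `Ψ^Φ_A(Div φ) = Div(Ψ φ)`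
  on ALL arrows, under `Cor411Setting`;
* `FrdI.exists_cor411iv_data_ofFunctor_weak` — the data `(Ψ^Base, η, Ψ^Φ)` of (iv) for the consumers ([EtTh] §3–§5,
  [IUTchI]);
* `FrdI.exists_cor411iii_compat_ofFunctor_weak` — (iii) WITH its compatibility clause with `Ψ^Prime`.
-/

namespace Literature.AlgebraicGeometry.Frobenioids

open CategoryTheory Opposite

universe w v v' u u'

namespace FrdI

open PreFrobenioid

variable {D₁ : Type u} [Category.{v} D₁] {Φ₁ : D₁ᵒᵖ ⥤ CommMonCat.{w}} {C₁ : Type u'} [Category.{v'} C₁]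
  {D₂ : Type u} [Category.{v} D₂] {Φ₂ : D₂ᵒᵖ ⥤ CommMonCat.{w}} {C₂ : Type u'} [Category.{v'} C₂]
  {F₁ : C₁ ⥤ ElemFrobenioid Φ₁} {F₂ : C₂ ⥤ ElemFrobenioid Φ₂}

/-! ### Cor. 4.11 (iii), (iv) -/

/-- **[FrdI] Cor. 4.11 (iii) AS TYPED from Thm. 3.4 (ii) AS TYPED** (for `Ψ` and `Ψ⁻¹`), Frobenioids with
WEAKLY perf-factorial `Φ_i`, `C₁` of rational type at THE birationalization / support; NO hypothesis on the bases (the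
typed (ii) is `PreFrobenioid.cor411ii_ofFunctor_of_thm34ii_weak`, seat abc-iut-L1-t12). [cite: MochizukiFrdI2008, Cor. 4.11 (iii) p.92] -/
theorem cor411iii_ofFunctor_of_thm34ii_weak (hF₁ : IsFrobenioid F₁) (hF₂ : IsFrobenioid F₂)
    (hpf₁ : Objectwise (fun M _ => IsPerfFactorialWeak M) Φ₁)
    (hpf₂ : Objectwise (fun M _ => IsPerfFactorialWeak M) Φ₂)
    (hrat₁ : ∀ A : C₁, PreFrobenioidData.IsRational
      (biratData hF₁ (hasBiratSquares_of_isFrobenioid hF₁))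
      (S := PreFrobenioidData.ofFunctor Φ₁ F₁) (fun a 𝔭 => PrimarySupp a 𝔭) A)
    (Ψ : C₁ ≌ C₂) (R₁ : (PreFrobenioidData.ofFunctor Φ₁ F₁).RSParams)
    (R₂ : (PreFrobenioidData.ofFunctor Φ₂ F₂).RSParams)
    (h : (PreFrobenioidData.ofFunctor Φ₁ F₁).Thm34ii (PreFrobenioidData.ofFunctor Φ₂ F₂) Ψ)
    (h' : (PreFrobenioidData.ofFunctor Φ₂ F₂).Thm34ii (PreFrobenioidData.ofFunctor Φ₁ F₁) Ψ.symm) :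
    (PreFrobenioidData.ofFunctor Φ₁ F₁).Cor411iii (PreFrobenioidData.ofFunctor Φ₂ F₂) Ψ R₁ R₂ :=
  cor411iii_ofFunctor_of_cor411ii_of_thm34ii_weak hF₁ hF₂ hpf₁ hpf₂ hrat₁ Ψ R₁ R₂ h h'
    (cor411ii_ofFunctor_of_thm34ii_weak hF₁ hF₂ Ψ hpf₁ hpf₂ h h')

/-- **[FrdI] Cor. 4.11 (iv) AS TYPED from Thm. 3.4 (ii) AS TYPED** (for `Ψ` and `Ψ⁻¹`), Frobenioids with
WEAKLY perf-factorial `Φ_i`, `C₁` of rational type at THE birationalization / support; NO hypothesis on the bases.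
[cite: MochizukiFrdI2008, Cor. 4.11 (iv) p.92] -/
theorem cor411iv_ofFunctor_of_thm34ii_weak (hF₁ : IsFrobenioid F₁) (hF₂ : IsFrobenioid F₂)
    (hpf₁ : Objectwise (fun M _ => IsPerfFactorialWeak M) Φ₁)
    (hpf₂ : Objectwise (fun M _ => IsPerfFactorialWeak M) Φ₂)
    (hrat₁ : ∀ A : C₁, PreFrobenioidData.IsRational
      (biratData hF₁ (hasBiratSquares_of_isFrobenioid hF₁))
      (S := PreFrobenioidData.ofFunctor Φ₁ F₁) (fun a 𝔭 => PrimarySupp a 𝔭) A)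
    (Ψ : C₁ ≌ C₂) (R₁ : (PreFrobenioidData.ofFunctor Φ₁ F₁).RSParams)
    (R₂ : (PreFrobenioidData.ofFunctor Φ₂ F₂).RSParams)
    (h : (PreFrobenioidData.ofFunctor Φ₁ F₁).Thm34ii (PreFrobenioidData.ofFunctor Φ₂ F₂) Ψ)
    (h' : (PreFrobenioidData.ofFunctor Φ₂ F₂).Thm34ii (PreFrobenioidData.ofFunctor Φ₁ F₁) Ψ.symm) :
    (PreFrobenioidData.ofFunctor Φ₁ F₁).Cor411iv (PreFrobenioidData.ofFunctor Φ₂ F₂) Ψ R₁ R₂ :=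
  cor411iv_ofFunctor_of_cor411ii_of_thm34ii_weak hF₁ hF₂ hpf₁ hpf₂ hrat₁ Ψ R₁ R₂ h h'
    (cor411ii_ofFunctor_of_thm34ii_weak hF₁ hF₂ Ψ hpf₁ hpf₂ h h')

/-- **[FrdI] Cor. 4.11 (iii) AS TYPED, in print's generality** ("there exists an isomorphism of functors
`Ψ^Φ : Φ₁ ⥲ Φ₂` lying over the equivalence `Ψ^Base`", p. 92): for EVERY pair of Frobenioids `C_i → F_{Φ_i}`
with WEAKLY perf-factorial `Φ_i`, EVERY equivalence `Ψ`, arbitrary `R_i`, and `C₁` of rational type at THE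
birationalization / support — NO hypothesis on the base categories: Thm. 3.4 (ii) as printed
(`FrdI.thm34ii_ofFunctor`) fed to `cor411iii_ofFunctor_of_thm34ii_weak`. [cite: MochizukiFrdI2008, Cor. 4.11 (iii) p.92] -/
theorem cor411iii_ofFunctor_weak (hF₁ : IsFrobenioid F₁) (hF₂ : IsFrobenioid F₂)
    (hpf₁ : Objectwise (fun M _ => IsPerfFactorialWeak M) Φ₁)
    (hpf₂ : Objectwise (fun M _ => IsPerfFactorialWeak M) Φ₂)
    (hrat₁ : ∀ A : C₁, PreFrobenioidData.IsRational
      (biratData hF₁ (hasBiratSquares_of_isFrobenioid hF₁))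
      (S := PreFrobenioidData.ofFunctor Φ₁ F₁) (fun a 𝔭 => PrimarySupp a 𝔭) A)
    (Ψ : C₁ ≌ C₂) (R₁ : (PreFrobenioidData.ofFunctor Φ₁ F₁).RSParams)
    (R₂ : (PreFrobenioidData.ofFunctor Φ₂ F₂).RSParams) :
    (PreFrobenioidData.ofFunctor Φ₁ F₁).Cor411iii (PreFrobenioidData.ofFunctor Φ₂ F₂) Ψ R₁ R₂ :=
  cor411iii_ofFunctor_of_thm34ii_weak hF₁ hF₂ hpf₁ hpf₂ hrat₁ Ψ R₁ R₂ (FrdI.thm34ii_ofFunctor hF₁ hF₂ Ψ)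
    (FrdI.thm34ii_ofFunctor hF₂ hF₁ Ψ.symm)

/-- **[FrdI] Cor. 4.11 (iv) AS TYPED, in print's generality** (Category-theoreticity of the functor to an
elementary Frobenioid: "a 1-commutative diagram `Ψ^F ∘ (C₁ → F_{Φ₁}) ≅ (C₂ → F_{Φ₂}) ∘ Ψ`", p. 92): for EVERY
pair of Frobenioids `C_i → F_{Φ_i}` with WEAKLY perf-factorial `Φ_i`, EVERY equivalence `Ψ`, arbitrary `R_i`, and `C₁`
of rational type at THE birationalization / support — NO hypothesis on the base categories.
[cite: MochizukiFrdI2008, Cor. 4.11 (iv) p.92] -/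
theorem cor411iv_ofFunctor_weak (hF₁ : IsFrobenioid F₁) (hF₂ : IsFrobenioid F₂)
    (hpf₁ : Objectwise (fun M _ => IsPerfFactorialWeak M) Φ₁)
    (hpf₂ : Objectwise (fun M _ => IsPerfFactorialWeak M) Φ₂)
    (hrat₁ : ∀ A : C₁, PreFrobenioidData.IsRational
      (biratData hF₁ (hasBiratSquares_of_isFrobenioid hF₁))
      (S := PreFrobenioidData.ofFunctor Φ₁ F₁) (fun a 𝔭 => PrimarySupp a 𝔭) A)
    (Ψ : C₁ ≌ C₂) (R₁ : (PreFrobenioidData.ofFunctor Φ₁ F₁).RSParams)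
    (R₂ : (PreFrobenioidData.ofFunctor Φ₂ F₂).RSParams) :
    (PreFrobenioidData.ofFunctor Φ₁ F₁).Cor411iv (PreFrobenioidData.ofFunctor Φ₂ F₂) Ψ R₁ R₂ :=
  cor411iv_ofFunctor_of_thm34ii_weak hF₁ hF₂ hpf₁ hpf₂ hrat₁ Ψ R₁ R₂ (FrdI.thm34ii_ofFunctor hF₁ hF₂ Ψ)
    (FrdI.thm34ii_ofFunctor hF₂ hF₁ Ψ.symm)

/-! ### Degrees, `Ψ^Φ` with its divisor clause, the data form and the compatibility clause -/

/-- **Thm. 4.9's `Ψ^Φ : Φ₁ ⥲ Φ₂` over `Ψ` WITH `Ψ^Φ_A(Div φ) = Div(Ψ φ)` on ALL arrows, under the hypotheses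
of Cor. 4.11, unconditionally** (every case; NO base hypothesis): Frobenioids with WEAKLY perf-factorial `Φ_i`, `C₁` of
rational type at THE birationalization / support. [cite: MochizukiFrdI2008, Thm. 4.9 p.89] -/
theorem exists_divisorMonoidIsoOver_div_ofFunctor_weak (hF₁ : IsFrobenioid F₁) (hF₂ : IsFrobenioid F₂)
    (hpf₁ : Objectwise (fun M _ => IsPerfFactorialWeak M) Φ₁)
    (hpf₂ : Objectwise (fun M _ => IsPerfFactorialWeak M) Φ₂)
    (hrat₁ : ∀ A : C₁, PreFrobenioidData.IsRational
      (biratData hF₁ (hasBiratSquares_of_isFrobenioid hF₁))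
      (S := PreFrobenioidData.ofFunctor Φ₁ F₁) (fun a 𝔭 => PrimarySupp a 𝔭) A)
    (Ψ : C₁ ≌ C₂) (hs : (PreFrobenioidData.ofFunctor Φ₁ F₁).Cor411Setting (PreFrobenioidData.ofFunctor Φ₂ F₂) Ψ) :
    ∃ E : (PreFrobenioidData.ofFunctor Φ₁ F₁).DivisorMonoidIsoOver (PreFrobenioidData.ofFunctor Φ₂ F₂) Ψ,
      ∀ ⦃A B : C₁⦄ (φ : A ⟶ B), E.iso A (Div F₁ φ) = Div F₂ (Ψ.functor.map φ) := by
  obtain ⟨h₁₂, -, hG⟩ := FrdI.thm34ii_ofFunctor hF₁ hF₂ Ψ hs.standard.1.quasiIsotropic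
    hs.standard.2.quasiIsotropic hs.standard.1.fsmff hs.standard.2.fsmff
  obtain ⟨h₂₁, -, hG'⟩ := FrdI.thm34ii_ofFunctor hF₂ hF₁ Ψ.symm hs.standard.2.quasiIsotropic
    hs.standard.1.quasiIsotropic hs.standard.2.fsmff hs.standard.1.fsmff
  exact exists_divisorMonoidIsoOver_div_of_cor411Setting_of_preservesPreSteps_weak hF₁ hF₂ hpf₁ hpf₂ hrat₁ Ψ h₁₂ h₂₁
    hG hG' hs

/-- **[FrdI] Cor. 4.11 (iv) for CONSUMERS, unconditionally** — the data `(Ψ^Base, η, Ψ^Φ)` with the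
`1`-unique base square, "`Ψ` preserves Frobenius degrees", the divisor formula `Div(Ψ φ) = η_A^* Ψ^Φ(Div φ)`
on ALL arrows, the typed rigidity clause `Cor411ivRigid` and the slim-base rigidity clause — for EVERY pair of
Frobenioids with WEAKLY perf-factorial `Φ_i` and EVERY `Ψ` under the typed `Cor411Setting`, `C₁` of rational type at
THE birationalization / support; NO hypothesis on the base categories. [cite: MochizukiFrdI2008, Cor. 4.11 (iv) p.92] -/
theorem exists_cor411iv_data_ofFunctor_weak (hF₁ : IsFrobenioid F₁) (hF₂ : IsFrobenioid F₂)
    (hpf₁ : Objectwise (fun M _ => IsPerfFactorialWeak M) Φ₁)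
    (hpf₂ : Objectwise (fun M _ => IsPerfFactorialWeak M) Φ₂)
    (hrat₁ : ∀ A : C₁, PreFrobenioidData.IsRational
      (biratData hF₁ (hasBiratSquares_of_isFrobenioid hF₁))
      (S := PreFrobenioidData.ofFunctor Φ₁ F₁) (fun a 𝔭 => PrimarySupp a 𝔭) A)
    (Ψ : C₁ ≌ C₂) (hs : (PreFrobenioidData.ofFunctor Φ₁ F₁).Cor411Setting (PreFrobenioidData.ofFunctor Φ₂ F₂) Ψ) :
    ∃ (ΨBase : D₁ ⥤ D₂)
      (E' : (PreFrobenioidData.ofFunctor Φ₁ F₁).DivisorMonoidIsoOverBase (PreFrobenioidData.ofFunctor Φ₂ F₂) ΨBase)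
      (η : Ψ.functor ⋙ (PreFrobenioidData.ofFunctor Φ₂ F₂).base ≅ (PreFrobenioidData.ofFunctor Φ₁ F₁).base ⋙ ΨBase),
      PreFrobenioidData.OneUniqueSquare Ψ.functor (PreFrobenioidData.ofFunctor Φ₁ F₁).base
        (PreFrobenioidData.ofFunctor Φ₂ F₂).base ΨBase ∧
      PreFrobenioidData.PreservesDegFr (PreFrobenioidData.ofFunctor Φ₁ F₁) (PreFrobenioidData.ofFunctor Φ₂ F₂) Ψ ∧
      (∀ ⦃A B : C₁⦄ (φ : A ⟶ B),
        Div F₂ (Ψ.functor.map φ) = pull Φ₂ (η.hom.app A) (E'.iso (baseObj F₁ A) (Div F₁ φ))) ∧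
      (PreFrobenioidData.ofFunctor Φ₁ F₁).Cor411ivRigid (PreFrobenioidData.ofFunctor Φ₂ F₂) Ψ ΨBase E' ∧
      (IsSlim D₁ → IsSlim D₂ → IsRigidFunctor (Ψ.functor ⋙ (PreFrobenioidData.ofFunctor Φ₂ F₂).base) ∧
        IsRigidFunctor ((PreFrobenioidData.ofFunctor Φ₁ F₁).base ⋙ ΨBase)) := by
  obtain ⟨h₁₂, -, hG⟩ := FrdI.thm34ii_ofFunctor hF₁ hF₂ Ψ hs.standard.1.quasiIsotropic
    hs.standard.2.quasiIsotropic hs.standard.1.fsmff hs.standard.2.fsmff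
  obtain ⟨h₂₁, -, hG'⟩ := FrdI.thm34ii_ofFunctor hF₂ hF₁ Ψ.symm hs.standard.2.quasiIsotropic
    hs.standard.1.quasiIsotropic hs.standard.2.fsmff hs.standard.1.fsmff
  exact exists_cor411iv_data_ofFunctor_of_cor411ii_of_preservesPreSteps_weak hF₁ hF₂ hpf₁ hpf₂ hrat₁ Ψ h₁₂ h₂₁ hG hG'
    hs (cor411ii_ofFunctor_weak hF₁ hF₂ Ψ hpf₁ hpf₂)

/-- **[FrdI] Cor. 4.11 (iii) WITH its compatibility clause, unconditionally**, for Frobenioids of isotropic,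
non-group-like type (`Thm42Setting`) with WEAKLY perf-factorial `Φ_i`, `C₁` of rational type at THE birationalization /
support, under the typed `Cor411Setting`; NO hypothesis on the base categories ("compatible … with the
isomorphism `Ψ^Prime` of Theorem 4.2, (ii)", p. 92). [cite: MochizukiFrdI2008, Cor. 4.11 (iii) p.92] -/
theorem exists_cor411iii_compat_ofFunctor_weak (hF₁ : IsFrobenioid F₁) (hF₂ : IsFrobenioid F₂)
    (hpf₁ : Objectwise (fun M _ => IsPerfFactorialWeak M) Φ₁)
    (hpf₂ : Objectwise (fun M _ => IsPerfFactorialWeak M) Φ₂)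
    (hrat₁ : ∀ A : C₁, PreFrobenioidData.IsRational
      (biratData hF₁ (hasBiratSquares_of_isFrobenioid hF₁))
      (S := PreFrobenioidData.ofFunctor Φ₁ F₁) (fun a 𝔭 => PrimarySupp a 𝔭) A)
    (Ψ : C₁ ≌ C₂)
    (hT : PreFrobenioidData.Thm42Setting (PreFrobenioidData.ofFunctor Φ₁ F₁) (PreFrobenioidData.ofFunctor Φ₂ F₂))
    (hs : (PreFrobenioidData.ofFunctor Φ₁ F₁).Cor411Setting (PreFrobenioidData.ofFunctor Φ₂ F₂) Ψ) :
    ∃ (e : ∀ A : C₁, Primes (Φ₁.obj (op (baseObj F₁ A))) ≃ Primes (Φ₂.obj (op (baseObj F₂ (Ψ.functor.obj A)))))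
      (E : (PreFrobenioidData.ofFunctor Φ₁ F₁).DivisorMonoidIsoOver (PreFrobenioidData.ofFunctor Φ₂ F₂) Ψ)
      (ΨBase : D₁ ⥤ D₂)
      (η : Ψ.functor ⋙ (PreFrobenioidData.ofFunctor Φ₂ F₂).base ≅ (PreFrobenioidData.ofFunctor Φ₁ F₁).base ⋙ ΨBase)
      (E' : (PreFrobenioidData.ofFunctor Φ₁ F₁).DivisorMonoidIsoOverBase (PreFrobenioidData.ofFunctor Φ₂ F₂) ΨBase)
      (e' : ∀ X : D₁, Primes (Φ₁.obj (op X)) ≃ Primes (Φ₂.obj (op (ΨBase.obj X)))),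
      (∀ (A : C₁) (𝔭 : Primes (Φ₁.obj (op (baseObj F₁ A)))),
        (∀ ⦃B : C₁⦄ (φ : A ⟶ B), IsCoAngularPreStep F₁ φ →
            (Div F₁ φ ∈ 𝔭.submonoid ↔ Div F₂ (Ψ.functor.map φ) ∈ (e A 𝔭).submonoid)) ∧
        ∀ ⦃B : C₁⦄ (ψ : B ⟶ A), IsCoAngularPreStep F₁ ψ →
          ((∃ y ∈ 𝔭.submonoid, pull Φ₁ (Base F₁ ψ) y = Div F₁ ψ) ↔
            ∃ y ∈ (e A 𝔭).submonoid, pull Φ₂ (Base F₂ (Ψ.functor.map ψ)) y = Div F₂ (Ψ.functor.map ψ))) ∧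
      (PreFrobenioidData.ofFunctor Φ₁ F₁).Thm49_compat (PreFrobenioidData.ofFunctor Φ₂ F₂) Ψ E e ∧
      PreFrobenioidData.OneUniqueSquare Ψ.functor (PreFrobenioidData.ofFunctor Φ₁ F₁).base
        (PreFrobenioidData.ofFunctor Φ₂ F₂).base ΨBase ∧
      (∀ (A : C₁) (x : Φ₁.obj (op (baseObj F₁ A))), E'.iso (baseObj F₁ A) x = pull Φ₂ (η.inv.app A) (E.iso A x)) ∧
      (PreFrobenioidData.ofFunctor Φ₁ F₁).Cor411iii_compat (PreFrobenioidData.ofFunctor Φ₂ F₂) E' e' := by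
  obtain ⟨h₁₂, -, -⟩ := FrdI.thm34ii_ofFunctor hF₁ hF₂ Ψ hs.standard.1.quasiIsotropic
    hs.standard.2.quasiIsotropic hs.standard.1.fsmff hs.standard.2.fsmff
  obtain ⟨h₂₁, -, -⟩ := FrdI.thm34ii_ofFunctor hF₂ hF₁ Ψ.symm hs.standard.2.quasiIsotropic
    hs.standard.1.quasiIsotropic hs.standard.2.fsmff hs.standard.1.fsmff
  exact exists_cor411iii_compat_ofFunctor_of_cor411ii_of_preservesPreSteps_weak hF₁ hF₂ hpf₁ hpf₂ hrat₁ Ψ hT hs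
    (fun _ _ φ h => h₁₂ φ h) (fun _ _ φ h => h₂₁ φ h) (cor411ii_ofFunctor_weak hF₁ hF₂ Ψ hpf₁ hpf₂)

end FrdI

end Literature.AlgebraicGeometry.Frobenioids
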